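import Summits.AtomisticToContinuum.HydrodynamicLimit.Theorems.LambertianContactSwapLambertianWellPosedKick

/-!
# The Lambertian hard-sphere recursion over a short window

Helper file (`--supports`) of the support item `LambertianWellPosed` of route `LambertianContactSwap`
(`AtomisticToContinuum/HydrodynamicLimit`, stmt-AtomisticToContinuum-12101); continuation of `…Kick`.
On a hit piece of the short-time good set (`Alexander.HitHyp ε r δ V z i j`, `4Vδ ≤ r`) with non-degenerate
first noise, the pre-kicked datum `J_ξ z` is a hit-piece datum with interaction length `2Vδ` whose
deterministic first collision is the Lambertian one (`hitHyp_lambertKick`); hence the Lambertian recursion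
is forward regular up to `δ` with `Λ_δ(z; ξs) = Φ_δ(J_{ξs 0} z)` and one collision (`lambert_window_hit`);
on the no-collision pieces it is the free flight (`lambert_window_free`).
-/

noncomputable section

open MeasureTheory ProbabilityTheory Set Function Filter Metric
open scoped ENNReal InnerProductSpace Real

namespace Summit.AtomisticToContinuum.HydrodynamicLimit.Theorems

open Literature.MathematicalPhysics.KineticTheory Literature.Analysis.FluidPDE
  Literature.Analysis.FluidPDE.Alexander

namespace LWindow

/-! ## One collision during the window, Lambertian version -/

section Hit

variable {d : Type*} [Fintype d] {N : ℕ} {ε r δ V : ℝ} {z : Config N d (UnitAddTorus d)} {i j : Fin N}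

/-- **The Lambertian step on a hit piece redraws its pair at the hitting time**:
`lambertStep ξ z = lambertPair i j (S_{τ₀} z) ξ`. [folklore] -/
theorem lambertStep_eq (h : HitHyp ε r δ V z i j) (ξ : EuclideanSpace ℝ d) :
    lambertStep (Torus.geometry d) ε ξ z = lambertPair (Torus.geometry d) i j (freeFlight (Torus.geometry d)
      (pairHitTime ε ((Torus.geometry d).sepVec (z i).1 (z j).1) ((z i).2 - (z j).2)) z) ξ := by
  have hs := h.isSimpleIncomingWith_freeFlight_hitTime
  rw [← h.toReal_freeExitTime] at hs ⊢
  exact lambertStep_eq_lambertPair h.freeExitTime_ne_top hs.incomingPairs_eq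

/-- The contact normal of the hit is nonzero. [folklore] -/
theorem hitPoint_ne_zero (h : HitHyp ε r δ V z i j) :
    hitPoint ε ((Torus.geometry d).sepVec (z i).1 (z j).1, (z i).2 - (z j).2) ≠ 0 := by
  intro h0; have := h.norm_hitPoint; rw [h0, norm_zero] at this; exact h.ε_pos.ne' this.symm

/-- **The pre-kicked datum is a hit-piece datum** with interaction length `2Vδ` (`4Vδ ≤ r`, non-degenerate
noise): it lies in `hitPiece N ε (2Vδ) δ i j`, on the same energy shell, and its deterministic data are the
Lambertian ones — `HitHyp ε (2Vδ) δ V (J_ξ z) i j`, hitting time `τ₀`, and first post-collisional state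
`stateAfter (J_ξ z) 1 = lambertPair i j (S_{τ₀} z) ξ`. [folklore] -/
theorem hitHyp_lambertKick (h : HitHyp ε r δ V z i j) (hr4 : 4 * V * δ ≤ r) {ξ : EuclideanSpace ℝ d}
    (hξ : lambertDir (hitPoint ε ((Torus.geometry d).sepVec (z i).1 (z j).1, (z i).2 - (z j).2)) ξ ≠ 0) :
    HitHyp ε (2 * V * δ) δ V (freeFlight (Torus.geometry d)
        (-pairHitTime ε ((Torus.geometry d).sepVec (z i).1 (z j).1) ((z i).2 - (z j).2))
        (collidePair (Torus.geometry d) i j (lambertPair (Torus.geometry d) i j (freeFlight (Torus.geometry d)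
          (pairHitTime ε ((Torus.geometry d).sepVec (z i).1 (z j).1) ((z i).2 - (z j).2)) z) ξ))) i j ∧
      pairHitTime ε ((Torus.geometry d).sepVec
          (freeFlight (Torus.geometry d)
            (-pairHitTime ε ((Torus.geometry d).sepVec (z i).1 (z j).1) ((z i).2 - (z j).2))
            (collidePair (Torus.geometry d) i j (lambertPair (Torus.geometry d) i j (freeFlight (Torus.geometry d)
              (pairHitTime ε ((Torus.geometry d).sepVec (z i).1 (z j).1) ((z i).2 - (z j).2)) z) ξ)) i).1
          (freeFlight (Torus.geometry d)
            (-pairHitTime ε ((Torus.geometry d).sepVec (z i).1 (z j).1) ((z i).2 - (z j).2))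
            (collidePair (Torus.geometry d) i j (lambertPair (Torus.geometry d) i j (freeFlight (Torus.geometry d)
              (pairHitTime ε ((Torus.geometry d).sepVec (z i).1 (z j).1) ((z i).2 - (z j).2)) z) ξ)) j).1)
        ((freeFlight (Torus.geometry d)
            (-pairHitTime ε ((Torus.geometry d).sepVec (z i).1 (z j).1) ((z i).2 - (z j).2))
            (collidePair (Torus.geometry d) i j (lambertPair (Torus.geometry d) i j (freeFlight (Torus.geometry d)
              (pairHitTime ε ((Torus.geometry d).sepVec (z i).1 (z j).1) ((z i).2 - (z j).2)) z) ξ)) i).2 -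
          (freeFlight (Torus.geometry d)
            (-pairHitTime ε ((Torus.geometry d).sepVec (z i).1 (z j).1) ((z i).2 - (z j).2))
            (collidePair (Torus.geometry d) i j (lambertPair (Torus.geometry d) i j (freeFlight (Torus.geometry d)
              (pairHitTime ε ((Torus.geometry d).sepVec (z i).1 (z j).1) ((z i).2 - (z j).2)) z) ξ)) j).2) =
        pairHitTime ε ((Torus.geometry d).sepVec (z i).1 (z j).1) ((z i).2 - (z j).2) ∧
      stateAfter (Torus.geometry d) ε (freeFlight (Torus.geometry d)
        (-pairHitTime ε ((Torus.geometry d).sepVec (z i).1 (z j).1) ((z i).2 - (z j).2))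
        (collidePair (Torus.geometry d) i j (lambertPair (Torus.geometry d) i j (freeFlight (Torus.geometry d)
          (pairHitTime ε ((Torus.geometry d).sepVec (z i).1 (z j).1) ((z i).2 - (z j).2)) z) ξ))) 1 =
        lambertPair (Torus.geometry d) i j (freeFlight (Torus.geometry d)
          (pairHitTime ε ((Torus.geometry d).sepVec (z i).1 (z j).1) ((z i).2 - (z j).2)) z) ξ := by
  set τ₀ := pairHitTime ε ((Torus.geometry d).sepVec (z i).1 (z j).1) ((z i).2 - (z j).2) with hτ₀
  set J := freeFlight (Torus.geometry d) (-τ₀) (collidePair (Torus.geometry d) i j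
    (lambertPair (Torus.geometry d) i j (freeFlight (Torus.geometry d) τ₀ z) ξ)) with hJ
  have hG := Torus.isHardSphereRegular_geometry (d := d) h.ε_lt
  set q : EuclideanSpace ℝ d := (Torus.geometry d).sepVec (z i).1 (z j).1 with hq
  set w : EuclideanSpace ℝ d := (z i).2 - (z j).2 with hw
  set n : EuclideanSpace ℝ d := hitPoint ε (q, w) with hn
  have hnq : n = q + τ₀ • w := rfl
  set m : EuclideanSpace ℝ d := lambertDir n ξ with hm
  set u' : EuclideanSpace ℝ d := ‖w‖ • (m - (2 * ⟪m, n⟫_ℝ / ‖n‖ ^ 2) • n) with hu'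
  set b : EuclideanSpace ℝ d := (2 : ℝ)⁻¹ • (w - u') with hb
  have hgood : ((q, w) : EuclideanSpace ℝ d × EuclideanSpace ℝ d) ∈ billiardGood ε := h.good
  have hV : ∀ k, ‖(z k).2‖ ≤ V := h.norm_vel_le
  have hwV : ‖w‖ ≤ 2 * V := norm_vel_sub_le hV i j
  have hτ0 : 0 < τ₀ := h.hitTime_pos
  have hτδ : τ₀ ≤ δ := h.hitTime_le
  have hnn : ‖n‖ = ε := h.norm_hitPoint
  have hVδ : 0 ≤ 2 * V * δ := mul_nonneg (mul_nonneg two_pos.le h.V_nonneg) h.δ_pos.le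
  obtain ⟨hgood', hτ', hnorm', -⟩ := redraw_mem_billiardGood (W := EuclideanSpace ℝ d) h.ε_pos hgood hξ
  change ((n - τ₀ • u', u') : EuclideanSpace ℝ d × EuclideanSpace ℝ d) ∈ billiardGood ε at hgood'
  change pairHitTime ε (n - τ₀ • u') u' = τ₀ at hτ'
  change ‖u'‖ = ‖w‖ at hnorm'
  -- size of the half-impulse
  have hbn : ‖b‖ ≤ 2 * V := by
    rw [hb, norm_smul, norm_inv, Real.norm_two]
    have : ‖w - u'‖ ≤ ‖w‖ + ‖u'‖ := norm_sub_le _ _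
    rw [hnorm'] at this
    nlinarith
  have hτb : ‖τ₀ • b‖ ≤ 2 * V * δ := by
    rw [norm_smul, Real.norm_of_nonneg hτ0.le]
    calc τ₀ * ‖b‖ ≤ δ * (2 * V) := mul_le_mul hτδ hbn (norm_nonneg _) h.δ_pos.le
      _ = 2 * V * δ := by ring
  -- chart condition for the coordinates of `J`
  have hchart : ‖(Torus.geometry d).sepVec (z i).1 (z j).1‖ + |τ₀| * ‖(z i).2 - (z j).2‖ < 1 / 2 := by
    rw [abs_of_pos hτ0]
    have h1 : τ₀ * ‖(z i).2 - (z j).2‖ ≤ δ * (2 * V) := mul_le_mul hτδ hwV (norm_nonneg _) h.δ_pos.le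
    have : (2⁻¹ : ℝ) = 1 / 2 := by norm_num
    nlinarith [h.norm_le, h.chart, h.window, h.r_nonneg]
  obtain ⟨HJi, HJj⟩ := lambertKick_apply_pair (ε := ε) h.ne z ξ hchart
  change J i = ((z i).1 + Literature.Analysis.FunctionSpaces.Torus.proj (τ₀ • b), (z i).2 - b) at HJi
  change J j = ((z j).1 - Literature.Analysis.FunctionSpaces.Torus.proj (τ₀ • b), (z j).2 + b) at HJj
  have HJk : ∀ k, k ≠ i → k ≠ j → J k = z k := fun k hki hkj => lambertKick_apply_of_ne hki hkj τ₀ z ξ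
  -- relative data of `J`
  have hrelv : (J i).2 - (J j).2 = u' := by
    rw [HJi, HJj]; dsimp only
    rw [hb, hw]
    module
  have hrelq : (Torus.geometry d).sepVec (J i).1 (J j).1 = n - τ₀ • u' := by
    rw [HJi, HJj]; dsimp only
    rw [sub_eq_add_neg ((z j).1), ← Literature.Analysis.FunctionSpaces.Torus.proj_neg]
    have hlt : ‖(Torus.geometry d).sepVec (z i).1 (z j).1‖ + ‖τ₀ • b - -(τ₀ • b)‖ < 1 / 2 := by
      rw [sub_neg_eq_add, ← two_smul ℝ (τ₀ • b), norm_smul, Real.norm_two]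
      have : (2⁻¹ : ℝ) = 1 / 2 := by norm_num
      nlinarith [h.norm_le, h.chart, hτb, h.r_nonneg, norm_nonneg (τ₀ • b)]
    have key := Torus.sepVec_translate_of_norm_lt hlt
    simp only [Torus.geometry_translate] at key
    rw [key, ← hq, sub_neg_eq_add, ← two_smul ℝ (τ₀ • b), hb, hnq]
    module
  -- displacements of the positions: only `i` and `j` move, by at most `2Vδ`
  have hdisp : ∀ k : Fin N, ∃ a : EuclideanSpace ℝ d,
      (J k).1 = (z k).1 + Literature.Analysis.FunctionSpaces.Torus.proj a ∧
        ‖a‖ ≤ (if k = i ∨ k = j then 2 * V * δ else 0) := by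
    intro k
    by_cases hki : k = i
    · subst hki; exact ⟨τ₀ • b, by rw [HJi], by rw [if_pos (Or.inl rfl)]; exact hτb⟩
    by_cases hkj : k = j
    · subst hkj
      refine ⟨-(τ₀ • b), ?_, by rw [if_pos (Or.inr rfl), norm_neg]; exact hτb⟩
      rw [HJj, Literature.Analysis.FunctionSpaces.Torus.proj_neg, ← sub_eq_add_neg]
    · refine ⟨0, by rw [HJk k hki hkj, Literature.Analysis.FunctionSpaces.Torus.proj_zero, add_zero], ?_⟩
      rw [norm_zero]; split_ifs <;> first | exact hVδ | exact le_rfl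
  -- membership in the hit piece with `r' = 2Vδ`
  have hothers : OthersFar ε (2 * V * δ) J i j := by
    intro k l hkl hne
    obtain ⟨a, hka, ha⟩ := hdisp k
    obtain ⟨c, hlc, hc⟩ := hdisp l
    have hdist := Torus.euclidDist_le_euclidDist_translate (z k).1 (z l).1 a c
    rw [← hka, ← hlc, ← Torus.norm_geometry_sepVec, ← Torus.norm_geometry_sepVec] at hdist
    have hfar : ε + r < ‖(Torus.geometry d).sepVec (z k).1 (z l).1‖ := h.othersFar k l hkl hne
    -- not both of `k, l` are in the pair
    have hsum : ‖a‖ + ‖c‖ ≤ 2 * V * δ := by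
      by_cases hk : k = i ∨ k = j
      · have hl : ¬ (l = i ∨ l = j) := by
          rintro hl
          rcases hk with rfl | rfl <;> rcases hl with rfl | rfl
          · exact hkl rfl
          · exact hne rfl
          · exact hne (Finset.pair_comm _ _)
          · exact hkl rfl
        rw [if_pos hk] at ha; rw [if_neg hl] at hc; linarith
      · rw [if_neg hk] at ha
        have : ‖c‖ ≤ 2 * V * δ := hc.trans (by split_ifs <;> first | exact le_rfl | exact hVδ)
        linarith
    have hac : ‖a - c‖ ≤ 2 * V * δ := (norm_sub_le a c).trans hsum
    linarith
  have hnormle : ‖(Torus.geometry d).sepVec (J i).1 (J j).1‖ ≤ ε + 2 * V * δ := by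
    rw [hrelq]
    calc ‖n - τ₀ • u'‖ ≤ ‖n‖ + ‖τ₀ • u'‖ := norm_sub_le _ _
      _ ≤ ε + 2 * V * δ := by
          rw [hnn, norm_smul, Real.norm_of_nonneg hτ0.le, hnorm']
          have : τ₀ * ‖w‖ ≤ δ * (2 * V) := mul_le_mul hτδ hwV (norm_nonneg _) h.δ_pos.le
          linarith
  have hmem : J ∈ hitPiece N ε (2 * V * δ) δ i j := by
    refine ⟨hothers, hnormle, ?_, ?_⟩
    · rw [hrelq, hrelv]; exact hgood'
    · rw [hrelq, hrelv, hτ']; exact hτδ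
  have henergy : configEnergy J ≤ V ^ 2 / 2 := by
    rw [hJ, configEnergy_freeFlight, configEnergy_collidePair h.ne,
      configEnergy_lambertPair h.ne _ _ (Or.inl ?_), configEnergy_freeFlight]
    · exact h.energy
    · rw [h.sepVec_freeFlight_hitTime]; exact hξ
  have hH : HitHyp ε (2 * V * δ) δ V J i j :=
    { ε_pos := h.ε_pos
      chart := by nlinarith [h.chart, h.window, hVδ, h.r_nonneg]
      window := le_rfl
      V_nonneg := h.V_nonneg
      energy := henergy
      lt := h.lt
      mem := hmem }
  have hτJ : pairHitTime ε ((Torus.geometry d).sepVec (J i).1 (J j).1) ((J i).2 - (J j).2) = τ₀ := by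
    rw [hrelq, hrelv, hτ']
  refine ⟨hH, hτJ, ?_⟩
  rw [hH.stateAfter_one, hτJ, hJ, ← freeFlight_add, add_neg_cancel, freeFlight_zero, collidePair_collidePair h.ne]

/-- **One Lambertian collision during the window**: on a hit piece (`4Vδ ≤ r`) with non-degenerate first
noise, the Lambertian recursion is forward regular up to `δ` (the three truncated clauses), its flow at time
`δ` is the deterministic flow of the pre-kicked datum, `Λ_δ(z; ξs) = Φ_δ(J_{ξs 0} z)`, and exactly one
collision is counted. [folklore] -/
theorem lambert_window_hit (h : HitHyp ε r δ V z i j) (hr4 : 4 * V * δ ≤ r) {ξs : ℕ → EuclideanSpace ℝ d}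
    (hξ : lambertDir (hitPoint ε ((Torus.geometry d).sepVec (z i).1 (z j).1, (z i).2 - (z j).2)) (ξs 0) ≠ 0) :
    (∀ k, lambertInstant (Torus.geometry d) ε ξs z (k + 1) ≤ ENNReal.ofReal δ →
      IsSimpleIncoming (Torus.geometry d) ε (freeFlight (Torus.geometry d)
        (freeExitTime (Torus.geometry d) ε (lambertStateAfter (Torus.geometry d) ε ξs z k)).toReal
          (lambertStateAfter (Torus.geometry d) ε ξs z k))) ∧
    (∀ k (t : ℝ), 0 < t → ENNReal.ofReal t < freeExitTime (Torus.geometry d) ε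
        (lambertStateAfter (Torus.geometry d) ε ξs z k) →
      lambertInstant (Torus.geometry d) ε ξs z k + ENNReal.ofReal t ≤ ENNReal.ofReal δ →
      ∀ a b : Fin N, a ≠ b → freeFlight (Torus.geometry d) t (lambertStateAfter (Torus.geometry d) ε ξs z k) ∉
        contactSet (Torus.geometry d) N ε a b) ∧
    (∃ k, ENNReal.ofReal δ < lambertInstant (Torus.geometry d) ε ξs z k) ∧
    lambertFlow (Torus.geometry d) ε ξs z δ = fwdFlow (Torus.geometry d) ε (freeFlight (Torus.geometry d)
        (-pairHitTime ε ((Torus.geometry d).sepVec (z i).1 (z j).1) ((z i).2 - (z j).2))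
        (collidePair (Torus.geometry d) i j (lambertPair (Torus.geometry d) i j (freeFlight (Torus.geometry d)
          (pairHitTime ε ((Torus.geometry d).sepVec (z i).1 (z j).1) ((z i).2 - (z j).2)) z) (ξs 0)))) δ ∧
    lambertCount (Torus.geometry d) ε ξs z δ = 1 := by
  set τ₀ := pairHitTime ε ((Torus.geometry d).sepVec (z i).1 (z j).1) ((z i).2 - (z j).2) with hτ₀
  set J := freeFlight (Torus.geometry d) (-τ₀) (collidePair (Torus.geometry d) i j
    (lambertPair (Torus.geometry d) i j (freeFlight (Torus.geometry d) τ₀ z) (ξs 0))) with hJ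
  obtain ⟨hH, hτJ, hone⟩ := hitHyp_lambertKick h hr4 hξ
  rw [← hτ₀, ← hJ] at hH hτJ hone
  set L₁ := lambertPair (Torus.geometry d) i j (freeFlight (Torus.geometry d) τ₀ z) (ξs 0) with hL₁
  have hstate1 : lambertStateAfter (Torus.geometry d) ε ξs z 1 = L₁ := by
    rw [lambertStateAfter_one, lambertStep_eq h]
  have hτ0 : 0 < τ₀ := h.hitTime_pos
  have hτδ : τ₀ ≤ δ := h.hitTime_le
  have ht1 : lambertInstant (Torus.geometry d) ε ξs z 1 = ENNReal.ofReal τ₀ := by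
    rw [lambertInstant_one, h.freeExitTime_eq]
  -- after the collision: no collision before the end of the window (deterministic analysis of `J`)
  have hexit1 : ENNReal.ofReal (δ - τ₀) < freeExitTime (Torus.geometry d) ε L₁ := by
    have := hH.ofReal_lt_freeExitTime_stateAfter_one
    rwa [hτJ, hone] at this
  have ht2 : ENNReal.ofReal δ < lambertInstant (Torus.geometry d) ε ξs z 2 := by
    rw [lambertInstant_succ, ht1, hstate1]
    have hsplit : ENNReal.ofReal δ = ENNReal.ofReal τ₀ + ENNReal.ofReal (δ - τ₀) := by
      rw [← ENNReal.ofReal_add hτ0.le (by linarith), add_sub_cancel]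
    rw [hsplit]
    exact ENNReal.add_lt_add_left ENNReal.ofReal_ne_top hexit1
  have hk2 : ∀ k, 2 ≤ k → ¬ lambertInstant (Torus.geometry d) ε ξs z k ≤ ENNReal.ofReal δ :=
    fun k hk hle => (not_le.2 ht2) ((monotone_lambertInstant ξs z hk).trans hle)
  refine ⟨fun k hk => ?_, fun k t ht htk hkt a b hab => ?_, ⟨2, ht2⟩, ?_, ?_⟩
  · cases k with
    | zero =>
      rw [lambertStateAfter_zero, h.toReal_freeExitTime]
      exact ⟨(i, j), h.isSimpleIncomingWith_freeFlight_hitTime⟩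
    | succ k => exact (hk2 (k + 2) (by omega) hk).elim
  · match k with
    | 0 =>
      rw [lambertStateAfter_zero]
      rw [lambertStateAfter_zero, h.freeExitTime_eq, ENNReal.ofReal_lt_ofReal_iff_of_nonneg ht.le] at htk
      exact fun hc => (h.lt_norm_sepVec_freeFlight_of_lt ht.le htk hab).ne' hc.2
    | 1 =>
      rw [ht1, ← ENNReal.ofReal_add hτ0.le ht.le, ENNReal.ofReal_le_ofReal_iff h.δ_pos.le] at hkt
      rw [hstate1, ← hone]
      have key := hH.lt_norm_sepVec_freeFlight_stateAfter_one ht (by rw [hτJ]; exact hkt) hab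
      exact fun hc => key.ne' hc.2
    | k + 2 => exact (hk2 (k + 2) (by omega) ((le_add_right le_rfl).trans hkt)).elim
  · have h1 : lambertInstant (Torus.geometry d) ε ξs z 1 ≤ ENNReal.ofReal δ := by
      rw [ht1]; exact ENNReal.ofReal_le_ofReal hτδ
    rw [lambertFlow_eq_of_segment h1 ht2, ht1, ENNReal.toReal_ofReal hτ0.le, hstate1, hH.fwdFlow_eq, hτJ, hone]
  · have h1 : lambertInstant (Torus.geometry d) ε ξs z 1 ≤ ENNReal.ofReal δ := by
      rw [ht1]; exact ENNReal.ofReal_le_ofReal hτδ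
    exact lambertCount_eq_of_segment h1 ht2

end Hit

/-! ## No collision during the window -/

section Free

variable {d : Type*} [Fintype d] {N : ℕ} {ε δ : ℝ} {z : Config N d (UnitAddTorus d)}

/-- **No Lambertian collision during the window**: if every pair of `S_t z` is at distance `> ε` for all
`t ∈ [0, δ]` (far set, no-hit pieces), the Lambertian recursion driven by any noise is forward regular up
to `δ`, its flow is the free flight on `[0, δ]` (hence the deterministic flow), and no collision is counted.
[folklore] -/
theorem lambert_window_free (hε' : ε < 2⁻¹) (hδ : 0 ≤ δ)
    (H : ∀ t ∈ Icc (0 : ℝ) δ, ∀ k l : Fin N, k ≠ l →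
      ε < ‖(Torus.geometry d).sepVec (freeFlight (Torus.geometry d) t z k).1 (freeFlight (Torus.geometry d) t z l).1‖)
    (ξs : ℕ → EuclideanSpace ℝ d) :
    (∀ k, lambertInstant (Torus.geometry d) ε ξs z (k + 1) ≤ ENNReal.ofReal δ →
      IsSimpleIncoming (Torus.geometry d) ε (freeFlight (Torus.geometry d)
        (freeExitTime (Torus.geometry d) ε (lambertStateAfter (Torus.geometry d) ε ξs z k)).toReal
          (lambertStateAfter (Torus.geometry d) ε ξs z k))) ∧
    (∀ k (t : ℝ), 0 < t → ENNReal.ofReal t < freeExitTime (Torus.geometry d) ε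
        (lambertStateAfter (Torus.geometry d) ε ξs z k) →
      lambertInstant (Torus.geometry d) ε ξs z k + ENNReal.ofReal t ≤ ENNReal.ofReal δ →
      ∀ a b : Fin N, a ≠ b → freeFlight (Torus.geometry d) t (lambertStateAfter (Torus.geometry d) ε ξs z k) ∉
        contactSet (Torus.geometry d) N ε a b) ∧
    (∃ k, ENNReal.ofReal δ < lambertInstant (Torus.geometry d) ε ξs z k) ∧
    (∀ s ∈ Icc (0 : ℝ) δ, lambertFlow (Torus.geometry d) ε ξs z s = fwdFlow (Torus.geometry d) ε z s) ∧
    lambertCount (Torus.geometry d) ε ξs z δ = 0 := by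
  have hτ := ofReal_lt_freeExitTime_of_forall_lt_norm hε' hδ H
  have h1 : ∀ k, ¬ lambertInstant (Torus.geometry d) ε ξs z (k + 1) ≤ ENNReal.ofReal δ := by
    intro k hk
    have hmono : lambertInstant (Torus.geometry d) ε ξs z 1 ≤ lambertInstant (Torus.geometry d) ε ξs z (k + 1) :=
      monotone_lambertInstant ξs z (by omega)
    rw [lambertInstant_one] at hmono
    exact (not_le.2 hτ) (hmono.trans hk)
  refine ⟨fun k hk => (h1 k hk).elim, fun k t ht htk hkt a b hab => ?_, ⟨1, by rwa [lambertInstant_one]⟩,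
    fun s hs => ?_, lambertCount_eq_zero_of_lt hτ⟩
  · cases k with
    | zero =>
      rw [lambertInstant_zero, zero_add] at hkt
      rw [lambertStateAfter_zero]
      intro hc
      exact (H t ⟨ht.le, (ENNReal.ofReal_le_ofReal_iff hδ).1 hkt⟩ a b hab).ne' hc.2
    | succ k => exact (h1 k ((le_add_right le_rfl).trans hkt)).elim
  · rw [lambertFlow_eq_freeFlight_of_lt ((ENNReal.ofReal_le_ofReal hs.2).trans_lt hτ),
      fwdFlow_eq_freeFlight_of_forall_lt_norm hε' hδ H hs]

end Free





end LWindow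

end Summit.AtomisticToContinuum.HydrodynamicLimit.Theorems
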